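import Literature.Computability.MetaComplexity.Resolution
import Literature.Computability.MetaComplexity.ResolutionWidth
import HarnessLib

/-!
# Restricting and renaming Resolution refutations without increasing their length

A standard tool of proof complexity [Ben-Sasson–Wigderson 2001, §2.2; Krajíček 2019, §5.1]: if
`π` is a Resolution refutation of a CNF `φ` and `ρ` is a partial assignment, then `π|ρ` is a
refutation of `φ|ρ` of at most the same length. We prove a slightly more general *transfer*
form, tailored to reductions between concrete CNF families (used for Garlík's transfer of his
lower bound from `REF^F_{s,t}` to the Atserias–Müller formula `REF(F,s)`,
`RefutationCNFProofs.lean`): given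

* a partial assignment `ρ : ν → Option Bool` of the variables of `φ : CNF ν`,
* a renaming `e : ν → μ` of variables, injective on the variables left unassigned by `ρ`,
* a target CNF `ψ : CNF μ` (non-empty) such that every clause of `φ` is either satisfied by `ρ`
  or restricts-and-renames to a clause of `ψ`,

every Resolution refutation `π` of `φ` (in the tree's calculus `IsResRefutation`: lines
`initial` / `resolve` / `weaken`) yields a Resolution refutation of `ψ` of THE SAME length
(`IsResRefutation.exists_map_restrict`). The new refutation is obtained line by line: a line whose
clause is satisfied by `ρ` becomes a junk `initial` line (some clause of `ψ`), any other line
`C` becomes `e(C|ρ)`; a resolution step on an unassigned pivot stays a resolution step, one on an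
assigned pivot becomes a weakening of the premise containing the falsified pivot literal.

Special cases: `ρ = ∅` gives transport of refutations along injective renamings (e.g. between a
structured variable type and its coding by `ℕ`), and `e = id` gives the classical restriction
lemma in length form (the width form is `resDerivable_restrict_of_isResRefutation` of
`ResolutionWidth.lean`, whose `SatisfiedBy` / `restrictClause` we reuse).

## References

* E. Ben-Sasson, A. Wigderson, *Short proofs are narrow — resolution made simple*, J. ACM 48
  (2001), §2.2 (restrictions of refutations).
* J. Krajíček, *Proof Complexity*, CUP 2019, §5.1.
* M. Garlík, *Resolution lower bounds for refutation statements*, MFCS 2019 / arXiv:1905.12372,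
  §7 (the substitution taking refutations of `REF(F,s̃)` to refutations of `REF^F_{n+1,t}`
  "without any increase in size").
-/

namespace Literature.Computability.MetaComplexity

open Literature.Computability.Complexity

variable {ν μ : Type*} [DecidableEq ν] [DecidableEq μ]

/-- Restricting by `ρ` and renaming along `e` commutes with erasing an unassigned literal, when `e`
is injective on the unassigned variables. [folklore] -/
theorem image_restrictClause_erase {ρ : ν → Option Bool} {e : ν → μ}
    (hinj : ∀ x y, ρ x = none → ρ y = none → e x = e y → x = y)
    (C : Finset (Literal ν)) {v : ν} (hv : ρ v = none) (b : Bool) :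
    (restrictClause ρ (C.erase (v, b))).image (fun l => ((e l.1, l.2) : Literal μ)) =
      ((restrictClause ρ C).image (fun l => ((e l.1, l.2) : Literal μ))).erase (e v, b) := by
  ext l'
  simp only [Finset.mem_image, mem_restrictClause, Finset.mem_erase, ne_eq]
  constructor
  · rintro ⟨l, ⟨⟨hne, hlC⟩, hρl⟩, rfl⟩
    refine ⟨?_, l, ⟨hlC, hρl⟩, rfl⟩
    intro h
    apply hne
    have h1 : e l.1 = e v := congrArg Prod.fst h
    have h2 : l.2 = b := congrArg Prod.snd h
    have := hinj l.1 v hρl hv h1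
    exact Prod.ext this h2
  · rintro ⟨hne, l, ⟨hlC, hρl⟩, rfl⟩
    refine ⟨l, ⟨⟨?_, hlC⟩, hρl⟩, rfl⟩
    rintro rfl
    exact hne rfl

/-- Restricting and renaming commutes with binary unions. [folklore] -/
theorem image_restrictClause_union {ρ : ν → Option Bool} {e : ν → μ}
    (C D : Finset (Literal ν)) :
    (restrictClause ρ (C ∪ D)).image (fun l => ((e l.1, l.2) : Literal μ)) =
      (restrictClause ρ C).image (fun l => ((e l.1, l.2) : Literal μ)) ∪
        (restrictClause ρ D).image (fun l => ((e l.1, l.2) : Literal μ)) := by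
  rw [← Finset.image_union]
  congr 1
  ext l
  simp only [mem_restrictClause, Finset.mem_union]
  tauto

/-- A premise of a resolution step whose conclusion is not satisfied by `ρ` is itself not
satisfied by `ρ`, unless `ρ` makes its pivot literal true. [Ben-Sasson–Wigderson 2001, §2.2]
[folklore] -/
theorem not_satisfiedBy_premise {ρ : ν → Option Bool} {C E : Finset (Literal ν)} {v : ν}
    {b : Bool} (hsub : C.erase (v, b) ⊆ E) (hE : ¬ SatisfiedBy ρ E) (hv : ρ v ≠ some b) :
    ¬ SatisfiedBy ρ C := by
  rintro ⟨l, hl, hρl⟩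
  refine hE ⟨l, hsub (Finset.mem_erase.2 ⟨?_, hl⟩), hρl⟩
  rintro rfl
  exact hv hρl

/-- **Restriction-and-renaming transfer of Resolution refutations, length form.** Let
`ρ : ν → Option Bool` be a partial assignment and `e : ν → μ` a renaming injective on the variables
unassigned by `ρ`; let `ψ : CNF μ` be non-empty and such that every set-clause of `φ` is either
satisfied by `ρ` or has its restriction-and-renaming `e(C|ρ)` among the set-clauses of `ψ`. Then
every Resolution refutation of `φ` yields a Resolution refutation of `ψ` of the same length
("`π|ρ` refutes `φ|ρ`", with satisfied lines replaced by a junk axiom so that line indices are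
kept). [Ben-Sasson–Wigderson 2001, §2.2; Garlík 2019, §7]
[cite: BenSassonWigderson2001, §2.2 (restriction of a refutation)] -/
theorem IsResRefutation.exists_map_restrict {φ : CNF ν} {ψ : CNF μ} (ρ : ν → Option Bool)
    (e : ν → μ) (hinj : ∀ x y, ρ x = none → ρ y = none → e x = e y → x = y) (hψ : ψ ≠ [])
    (hcl : ∀ C ∈ φ.clauseFinsets, SatisfiedBy ρ C ∨
      (restrictClause ρ C).image (fun l => ((e l.1, l.2) : Literal μ)) ∈ ψ.clauseFinsets)
    {π : List (ResLine ν)} (hπ : IsResRefutation φ π) :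
    ∃ π' : List (ResLine μ), IsResRefutation ψ π' ∧ π'.length = π.length := by
  classical
  -- a junk axiom for the satisfied lines
  obtain ⟨C₀, hC₀⟩ : ∃ C₀ : Finset (Literal μ), C₀ ∈ ψ.clauseFinsets := by
    obtain ⟨c, hc⟩ := List.exists_mem_of_ne_nil ψ hψ
    exact ⟨c.toFinset, List.mem_map.2 ⟨c, hc, rfl⟩⟩
  -- the literal renaming, the rule translation and the line translation
  let ê : Literal ν → Literal μ := fun l => (e l.1, l.2)
  let TR : ResRule ν → ResRule μ := fun r =>
    match r with
    | .initial => .initial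
    | .weaken i => .weaken i
    | .resolve i j v =>
      match ρ v with
      | none => .resolve i j (e v)
      | some true => .weaken j
      | some false => .weaken i
  let T : ResLine ν → ResLine μ := fun l =>
    if SatisfiedBy ρ l.clause then ⟨C₀, .initial⟩ else ⟨(restrictClause ρ l.clause).image ê, TR l.rule⟩
  have hT_sat : ∀ l : ResLine ν, SatisfiedBy ρ l.clause → T l = ⟨C₀, .initial⟩ :=
    fun l h => if_pos h
  have hT_ns : ∀ l : ResLine ν, ¬ SatisfiedBy ρ l.clause →
      T l = ⟨(restrictClause ρ l.clause).image ê, TR l.rule⟩ := fun l h => if_neg h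
  -- one line
  have key : ∀ (prev : List (ResLine ν)) (l : ResLine ν), IsValidResLine φ prev l →
      IsValidResLine ψ (prev.map T) (T l) := by
    intro prev l hv
    by_cases hsat : SatisfiedBy ρ l.clause
    · rw [hT_sat l hsat]
      exact hC₀
    rw [hT_ns l hsat]
    obtain ⟨C, r⟩ := l
    simp only at hsat ⊢
    cases r with
    | initial =>
      unfold IsValidResLine at hv ⊢
      rcases hcl C hv with h | h
      · exact absurd h hsat
      · exact h
    | weaken i =>
      unfold IsValidResLine at hv ⊢
      obtain ⟨hi, hsub⟩ := hv
      have hns : ¬ SatisfiedBy ρ (prev[i]).clause := fun h => hsat (h.mono hsub)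
      refine ⟨by simpa using hi, ?_⟩
      simp only [List.getElem_map]
      rw [hT_ns _ hns]
      exact Finset.image_subset_image (restrictClause_mono hsub)
    | resolve i j v =>
      unfold IsValidResLine at hv
      obtain ⟨hi, hj, hvC, hvD, hE⟩ := hv
      simp only at hE
      have hi' : i < (prev.map T).length := by simpa using hi
      have hj' : j < (prev.map T).length := by simpa using hj
      rcases hρv : ρ v with _ | _ | _
      · -- unassigned pivot: a resolution step on `e v`
        have hns₁ : ¬ SatisfiedBy ρ (prev[i]).clause :=
          not_satisfiedBy_premise (b := true) (by rw [hE]; exact Finset.subset_union_left) hsat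
            (by rw [hρv]; simp)
        have hns₂ : ¬ SatisfiedBy ρ (prev[j]).clause :=
          not_satisfiedBy_premise (b := false) (by rw [hE]; exact Finset.subset_union_right) hsat
            (by rw [hρv]; simp)
        have hTR : TR (.resolve i j v) = .resolve i j (e v) := by simp only [TR, hρv]
        rw [hTR]
        unfold IsValidResLine
        refine ⟨hi', hj', ?_, ?_, ?_⟩
        · simp only [List.getElem_map]
          rw [hT_ns _ hns₁]
          exact Finset.mem_image.2 ⟨(v, true), mem_restrictClause.2 ⟨hvC, hρv⟩, rfl⟩
        · simp only [List.getElem_map]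
          rw [hT_ns _ hns₂]
          exact Finset.mem_image.2 ⟨(v, false), mem_restrictClause.2 ⟨hvD, hρv⟩, rfl⟩
        · simp only [List.getElem_map]
          rw [hT_ns _ hns₁, hT_ns _ hns₂]
          simp only
          rw [hE, image_restrictClause_union, image_restrictClause_erase hinj _ hρv,
            image_restrictClause_erase hinj _ hρv]
      · -- `ρ v = false`: the premise `prev[i] ∋ (v, true)` is not satisfied; weaken it
        have hns₁ : ¬ SatisfiedBy ρ (prev[i]).clause :=
          not_satisfiedBy_premise (b := true) (by rw [hE]; exact Finset.subset_union_left) hsat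
            (by rw [hρv]; simp)
        have hTR : TR (.resolve i j v) = .weaken i := by simp only [TR, hρv]
        rw [hTR]
        unfold IsValidResLine
        refine ⟨hi', ?_⟩
        simp only [List.getElem_map]
        rw [hT_ns _ hns₁]
        refine Finset.image_subset_image (fun l hl => ?_)
        rw [mem_restrictClause] at hl ⊢
        refine ⟨?_, hl.2⟩
        rw [hE]
        refine Finset.mem_union_left _ (Finset.mem_erase.2 ⟨?_, hl.1⟩)
        rintro rfl
        exact absurd hl.2 (by rw [hρv]; simp)
      · -- `ρ v = true`: the premise `prev[j] ∋ (v, false)` is not satisfied; weaken it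
        have hns₂ : ¬ SatisfiedBy ρ (prev[j]).clause :=
          not_satisfiedBy_premise (b := false) (by rw [hE]; exact Finset.subset_union_right) hsat
            (by rw [hρv]; simp)
        have hTR : TR (.resolve i j v) = .weaken j := by simp only [TR, hρv]
        rw [hTR]
        unfold IsValidResLine
        refine ⟨hj', ?_⟩
        simp only [List.getElem_map]
        rw [hT_ns _ hns₂]
        refine Finset.image_subset_image (fun l hl => ?_)
        rw [mem_restrictClause] at hl ⊢
        refine ⟨?_, hl.2⟩
        rw [hE]
        refine Finset.mem_union_right _ (Finset.mem_erase.2 ⟨?_, hl.1⟩)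
        rintro rfl
        exact absurd hl.2 (by rw [hρv]; simp)
  refine ⟨π.map T, ⟨?_, ?_⟩, List.length_map _⟩
  · intro k hk
    have hk' : k < π.length := by simpa using hk
    have hv := hπ.1 k hk'
    have h := key (π.take k) (π[k]) hv
    simp only [List.getElem_map]
    rw [List.map_take] at h
    exact h
  · obtain ⟨l, hl, hle⟩ := hπ.2
    refine ⟨T l, List.mem_map.2 ⟨l, hl, rfl⟩, ?_⟩
    have hns : ¬ SatisfiedBy ρ l.clause := by rw [hle]; exact not_satisfiedBy_empty
    rw [hT_ns l hns]
    simp [hle]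

/-- **Renaming transfer** (the case `ρ = ∅`): along a renaming `e` injective on `ν`, such that
every set-clause of `φ` renames to a set-clause of the non-empty `ψ`, refutations of `φ` yield
refutations of `ψ` of the same length. [folklore] -/
theorem IsResRefutation.exists_map_rename {φ : CNF ν} {ψ : CNF μ} (e : ν → μ)
    (hinj : Function.Injective e) (hψ : ψ ≠ [])
    (hcl : ∀ C ∈ φ.clauseFinsets, C.image (fun l => ((e l.1, l.2) : Literal μ)) ∈ ψ.clauseFinsets)
    {π : List (ResLine ν)} (hπ : IsResRefutation φ π) :
    ∃ π' : List (ResLine μ), IsResRefutation ψ π' ∧ π'.length = π.length := by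
  refine hπ.exists_map_restrict (fun _ => none) e (fun x y _ _ h => hinj h) hψ fun C hC => ?_
  right
  rw [restrictClause_none]
  exact hcl C hC

/-- **Restriction of refutations, length form** (the case `e = id`): if every set-clause of `φ`
not satisfied by `ρ` restricts to a set-clause of the non-empty `ψ`, then
`minResRefutationSize ψ ≤ minResRefutationSize φ` in the strong sense that every refutation of
`φ` yields one of `ψ` of the same length. [Ben-Sasson–Wigderson 2001, §2.2]
[cite: BenSassonWigderson2001, §2.2 (restriction of a refutation)] -/
theorem IsResRefutation.exists_restrict {φ ψ : CNF ν} (ρ : ν → Option Bool) (hψ : ψ ≠ [])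
    (hcl : ∀ C ∈ φ.clauseFinsets, SatisfiedBy ρ C ∨ restrictClause ρ C ∈ ψ.clauseFinsets)
    {π : List (ResLine ν)} (hπ : IsResRefutation φ π) :
    ∃ π' : List (ResLine ν), IsResRefutation ψ π' ∧ π'.length = π.length := by
  refine hπ.exists_map_restrict ρ id (fun x y _ _ h => h) hψ fun C hC => ?_
  rcases hcl C hC with h | h
  · exact Or.inl h
  · right
    have hid : (fun l : Literal ν => ((id l.1, l.2) : Literal ν)) = id := by
      funext l; rfl
    rw [hid, Finset.image_id]
    exact h

end Literature.Computability.MetaComplexity
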